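import Mathlib

/-!
# The DIGIT LEMMA of `tables/KR-FREE.md` §5 — every level (`HodgeFermat/DigitLemma.lean`; HF-G20a)

Tree copy (whole module) of the module `HodgeFermat/DigitLemma.lean` of the sibling cell's standalone package
`run/shared/lean/pub/pub-hodgefermat/lean/HodgeFermat/` (318 lines, sha256 `da0ffda903e546a9…`), source lines 25–318 (all: `ThreeSmooth`, `NoDigitTwo`, the DIGIT LEMMA `digit_lemma` and its corollaries).
Filed by cell `pub-hfermat`, seat prover-1 gen-3, on the COORDINATOR KEEPER RULING of 2026-08-25 (gem sweep H1: take the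
off-gate kernel theorem `thmFstar` through the gate) — here THEOREM F* of `tables/DPRIME-THEOREM.md` §9 IN FULL, i.e.
PROPOSITION D′(3N) and the descent (`HodgeFermat/PropDPrimeNFinal.lean`, GATE HF-G34), the last off-gate form of THEOREM F*
(its first two forms, `DecodingFinal.thmFstar` = F* at the prime levels and `ThmFstarNFinal.thmFstar` = F*(3N), landed on
2026-08-25 as `HodgeFermatThmFstar.lean` / `HodgeFermatThmFstarN.lean`, seats prover-1 gen-0 / gen-2); this file is one link of
the import closure of `PropDPrimeNFinal.propDprime` (the sibling's KR-free chain: THEOREM L, COROLLARY M, THEOREM D6,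
THEOREM U⁺, THEOREM KR6, THEOREM Z3U) on top of those landed chains.  The source module is the sibling's hub-checked module of
record (pub-hodgefermat `CERT.md` l.864, GATE HF-G20a); its declarations are copied VERBATIM.
Deviations from the source module, exhaustively: the `import` lines (tree modules `Summits.HodgeConjecture.FermatCycles.
HodgeFermat*` instead of `HodgeFermat.*`); this module docstring; one-line docstrings added (gate lint) to `threeSmooth_coprime`.
Every other line — in particular every declaration's statement and proof — is byte-identical to the source.
HONEST FRAMING: explicit algebraic cycles for specific Hodge classes on Fermat/Delsarte varieties; residual open instances
listed; no claim on general Hodge.  (This file is arithmetic of CM types / finite combinatorics / analytic number theory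
of the sibling's KR-free programme; it claims nothing about cycles.)

The source module's docstring (DigitLemma.lean l.3–23), verbatim:

## The DIGIT LEMMA of `tables/KR-FREE.md` §5 — kernel-checked for every level (build hodge-fermat, generation 20)

Koblitz–Rohrlich (Canad. J. Math. 30 (1978), p. 1195) state a "Lemma" about first digits of multiples
"whose proof is straightforward and will be omitted"; its second part is what `tables/KR-FREE.md` §5 calls the
DIGIT LEMMA and uses (via PROPOSITION Z5, §6) to exclude the pattern (Z1, Z1) at the prime 5 in THEOREM D6
("no two distinct triples of a squarefree level prime to 6 share a CM type").  The hand proof of §5 was written by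
generation 18 and refereed by generation 19; this file proves the lemma in Lean 4 + Mathlib for EVERY `n > 20` prime
to 30, following the four steps of §5 (with the 3-smooth chain started at `u = 2` instead of `u = 4`, which makes
Step 1 shorter; the mathematics is otherwise identical).

Notation.  For `n > 1` and an integer `u`, `⟨u⟩_n = u % n` and `d(u) := ⌊5⟨u⟩_n / n⌋ ∈ {0,…,4}` (`digit n u`), the
first 5-adic digit of `⟨u⟩_n / n`.  The hypothesis of the lemma for `w` is
`DigitClose n w : ∀ u ∈ (ℤ/n)ˣ, |d(u) − d(uw)| ≤ 2` (units = `0 < u < n`, `gcd(u,n) = 1`).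

**DIGIT LEMMA** (`digit_lemma`).  Let `gcd(n, 30) = 1`, `n > 20`, `w ∈ (ℤ/n)ˣ`, `w ≠ 1`.  If `|d(u) − d(uw)| ≤ 2`
for every unit `u`, then `w = 2` or `w = 2⁻¹ = (n+1)/2`.

No `sorry`, no `native_decide`; axioms: see `#print axioms` at the end (expected `[propext, Classical.choice,
Quot.sound]`, the Mathlib baseline).  Companion file for §4: `L5Fibre.lean`.
-/

namespace HodgeFermat.KRFree

/-- the first 5-adic digit of `⟨u⟩_n / n`: `d(u) = ⌊5⟨u⟩_n / n⌋` -/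
def digit (n u : ℕ) : ℕ := 5 * (u % n) / n

/-- the hypothesis of the DIGIT LEMMA for `w` at level `n`: `|d(u) − d(uw)| ≤ 2` for every unit `u` of `ℤ/n` -/
def DigitClose (n w : ℕ) : Prop :=
  ∀ u, 0 < u → u < n → Nat.Coprime u n →
    digit n (u * w) ≤ digit n u + 2 ∧ digit n u ≤ digit n (u * w) + 2

/-! ## Arithmetic helpers -/

/-- `x % m` from an explicit representation `x = q m + r`, `r < m` -/
lemma mod_eq_of_repr {x m q r : ℕ} (h : x = q * m + r) (hr : r < m) : x % m = r := by
  subst h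
  rw [Nat.mul_comm, Nat.mul_add_mod]
  exact Nat.mod_eq_of_lt hr

/-- the hypothesis at a unit `u < n/5` (where `d(u) = 0`) says `d(uw) ≤ 2`, i.e. `5⟨uw⟩_n < 3n` -/
lemma H_small {n w : ℕ} (H : DigitClose n w) (hn : 0 < n) (u : ℕ) (hu0 : 0 < u) (hu : 5 * u < n)
    (hcu : Nat.Coprime u n) : 5 * (u * w % n) < 3 * n := by
  have hun : u < n := by omega
  obtain ⟨h1, -⟩ := H u hu0 hun hcu
  have hd0 : digit n u = 0 := by
    unfold digit
    rw [Nat.mod_eq_of_lt hun]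
    exact Nat.div_eq_of_lt (by omega)
  rw [hd0, Nat.zero_add] at h1
  unfold digit at h1
  have h3 : 5 * (u * w % n) / n < 3 := by omega
  exact (Nat.div_lt_iff_lt_mul hn).mp h3

/-! ## Step 1: `u = 1, 2, 3` -/

/-- after `u = 1, 2, 3`: either `⟨w⟩/n < 3/10` (case A) or `1/2 ≤ ⟨w⟩/n < 8/15` (case B) -/
lemma step1 {n w : ℕ} (hn : 20 < n) (hwn : w < n) (H : DigitClose n w)
    (hc2 : Nat.Coprime 2 n) (hc3 : Nat.Coprime 3 n) :
    10 * w < 3 * n ∨ (n ≤ 2 * w ∧ 15 * w < 8 * n) := by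
  have hn0 : 0 < n := by omega
  have h1 := H_small H hn0 1 (by omega) (by omega) (Nat.coprime_one_left n)
  rw [Nat.one_mul, Nat.mod_eq_of_lt hwn] at h1
  have h2 := H_small H hn0 2 (by omega) (by omega) hc2
  by_cases hA : 2 * w < n
  · left
    rw [Nat.mod_eq_of_lt hA] at h2
    omega
  · right
    have hB : n ≤ 2 * w := by omega
    refine ⟨hB, ?_⟩
    have h3 := H_small H hn0 3 (by omega) (by omega) hc3
    rw [mod_eq_of_repr (q := 1) (r := 3 * w - n) (by omega) (by omega)] at h3
    omega

/-! ## Step 2 (case A): the 3-smooth chain -/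

/-- `s` is 3-smooth: `s = 2^a 3^b` -/
def ThreeSmooth (s : ℕ) : Prop := ∃ a b : ℕ, s = 2 ^ a * 3 ^ b

/-- a 3-smooth number is prime to every `n` prime to `6` -/
lemma threeSmooth_coprime {s n : ℕ} (hs : ThreeSmooth s) (hc2 : Nat.Coprime 2 n)
    (hc3 : Nat.Coprime 3 n) : Nat.Coprime s n := by
  obtain ⟨a, b, rfl⟩ := hs
  exact Nat.coprime_mul_iff_left.mpr ⟨Nat.Coprime.pow_left a hc2, Nat.Coprime.pow_left b hc3⟩

/-- the predecessor in the chain: a 3-smooth `s ≥ 3` has a 3-smooth `s'` with `2 ≤ s' < s` and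
`s = (3/2) s'` or `s = (4/3) s'` -/
lemma threeSmooth_pred {s : ℕ} (hs : ThreeSmooth s) (h3 : 3 ≤ s) :
    ∃ s', ThreeSmooth s' ∧ 2 ≤ s' ∧ s' < s ∧ (2 * s = 3 * s' ∨ 3 * s = 4 * s') := by
  obtain ⟨a, b, rfl⟩ := hs
  cases b with
  | succ b' =>
    have hpos : 0 < 2 ^ a * 3 ^ b' := by positivity
    refine ⟨2 ^ (a + 1) * 3 ^ b', ⟨a + 1, b', rfl⟩, ?_, ?_, ?_⟩
    · have h2 : 2 ^ (a + 1) * 3 ^ b' = 2 * (2 ^ a * 3 ^ b') := by ring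
      omega
    · have h2 : 2 ^ (a + 1) * 3 ^ b' = 2 * (2 ^ a * 3 ^ b') := by ring
      have h3' : 2 ^ a * 3 ^ (b' + 1) = 3 * (2 ^ a * 3 ^ b') := by ring
      omega
    · left; ring
  | zero =>
    simp only [pow_zero, Nat.mul_one] at h3 ⊢
    rcases a with _ | _ | a''
    · simp at h3
    · simp at h3
    · have hP : 1 ≤ 2 ^ a'' := Nat.one_le_two_pow
      refine ⟨2 ^ a'' * 3, ⟨a'', 1, by ring⟩, by omega, ?_, ?_⟩
      · have h4 : 2 ^ (a'' + 2) = 4 * 2 ^ a'' := by ring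
        omega
      · right; ring

/-- case A, the chain: `5 s ⟨w⟩ < 3 n` for every 3-smooth `2 ≤ s < n/5` -/
lemma chainA {n w : ℕ} (hn : 20 < n) (H : DigitClose n w) (hc2 : Nat.Coprime 2 n)
    (hc3 : Nat.Coprime 3 n) (hA : 10 * w < 3 * n) :
    ∀ s, ThreeSmooth s → 2 ≤ s → 5 * s < n → 5 * (s * w) < 3 * n := by
  intro s
  induction s using Nat.strong_induction_on with
  | _ s ih =>
    intro hs h2 h5
    by_cases hs2 : s = 2
    · subst hs2
      have h := H_small H (by omega) 2 (by omega) (by omega) hc2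
      rw [Nat.mod_eq_of_lt (by omega : 2 * w < n)] at h
      omega
    · obtain ⟨s', hs', h2', hlt, hrel⟩ := threeSmooth_pred hs (by omega)
      have ih' := ih s' hlt hs' h2' (by omega)
      have hsw : s * w < n := by
        rcases hrel with hrel | hrel
        · have e : 2 * (s * w) = 3 * (s' * w) := by
            rw [show 2 * (s * w) = (2 * s) * w by ring, hrel]; ring
          omega
        · have e : 3 * (s * w) = 4 * (s' * w) := by
            rw [show 3 * (s * w) = (3 * s) * w by ring, hrel]; ring
          omega
      have h := H_small H (by omega) s (by omega) h5 (threeSmooth_coprime hs hc2 hc3)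
      rw [Nat.mod_eq_of_lt hsw] at h
      exact h

/-- a 3-smooth `U` with `2n/15 < U < n/5` (the last link of the chain) -/
lemma exists_U {n : ℕ} (hn : 20 < n) (h5 : ¬ 5 ∣ n) :
    ∃ s, ThreeSmooth s ∧ 2 ≤ s ∧ 5 * s < n ∧ 2 * n < 15 * s := by
  have ht2 : 2 ≤ 2 * n / 15 := by omega
  have ha1 : 1 ≤ Nat.log 2 (2 * n / 15) := Nat.log_pos (by norm_num) ht2
  obtain ⟨a', ha'⟩ : ∃ a', Nat.log 2 (2 * n / 15) = a' + 1 :=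
    ⟨Nat.log 2 (2 * n / 15) - 1, by omega⟩
  have h1 := Nat.pow_log_le_self 2 (x := 2 * n / 15) (by omega)
  have h2 := Nat.lt_pow_succ_log_self (b := 2) (by norm_num) (2 * n / 15)
  rw [ha'] at h1 h2
  rw [pow_succ] at h1
  rw [Nat.succ_eq_add_one, pow_succ, pow_succ] at h2
  have hP : 1 ≤ 2 ^ a' := Nat.one_le_two_pow
  have h15 : 15 * 2 ^ a' ≤ n := by omega
  have h15' : 15 * 2 ^ a' ≠ n := fun h => h5 ⟨3 * 2 ^ a', by omega⟩
  by_cases hc : 2 * n < 45 * 2 ^ a'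
  · exact ⟨3 * 2 ^ a', ⟨a', 1, by ring⟩, by omega, by omega, by omega⟩
  · exact ⟨4 * 2 ^ a', ⟨a' + 2, 0, by ring⟩, by omega, by omega, by omega⟩

/-- case A gives `⟨w⟩ ≤ 4` -/
lemma caseA {n w : ℕ} (hn : 20 < n) (h5 : ¬ 5 ∣ n) (H : DigitClose n w) (hc2 : Nat.Coprime 2 n)
    (hc3 : Nat.Coprime 3 n) (hA : 10 * w < 3 * n) : w ≤ 4 := by
  obtain ⟨s, hs, h2, h5s, h15⟩ := exists_U hn h5
  have h := chainA hn H hc2 hc3 hA s hs h2 h5s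
  have h' : s * (10 * w) < s * 45 := by
    calc s * (10 * w) = 10 * (s * w) := by ring
      _ < 45 * s := by omega
      _ = s * 45 := by ring
  have := Nat.lt_of_mul_lt_mul_left h'
  omega

/-! ## Step 3 (case B): the powers of 3 -/

/-- case B, the chain over powers of 3: with `D := 2⟨w⟩ − n` (odd, positive), `5 · 3^k · D < n` whenever `5 · 3^k < n` -/
lemma chainB {n w : ℕ} (hn : 20 < n) (hodd : n % 2 = 1) (H : DigitClose n w) (hc3 : Nat.Coprime 3 n)
    (hB : n ≤ 2 * w) (hB' : 15 * w < 8 * n) :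
    ∀ k, 1 ≤ k → 5 * 3 ^ k < n → 5 * (3 ^ k * (2 * w - n)) < n := by
  intro k hk
  induction k with
  | zero => omega
  | succ k ih =>
    intro h5
    rcases Nat.eq_zero_or_pos k with rfl | hkpos
    · simp only [Nat.zero_add, pow_one]
      omega
    · have hlt : 3 ^ k < 3 ^ (k + 1) := Nat.pow_lt_pow_right (by norm_num) (by omega)
      have ih' := ih hkpos (by omega)
      obtain ⟨j, hj⟩ : ∃ j, 3 ^ k = 2 * j + 1 :=
        ⟨3 ^ k / 2, by have := Nat.odd_iff.mp (Odd.pow (by decide : Odd 3) : Odd (3 ^ k)); omega⟩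
      have hu : 3 ^ (k + 1) = 6 * j + 3 := by rw [pow_succ]; omega
      obtain ⟨D, hD⟩ : ∃ D, D = 2 * w - n := ⟨_, rfl⟩
      have h2w : 2 * w = n + D := by omega
      have hDodd : D % 2 = 1 := by omega
      rw [hj, ← hD] at ih'
      rw [hu, ← hD]
      -- the identity `u w = ((u-1)/2) n + (n + u D)/2` for the odd `u = 3^(k+1) = 6j+3`
      have hid : 2 * ((6 * j + 3) * w) = 2 * ((3 * j + 1) * n) + (n + (6 * j + 3) * D) := by
        calc 2 * ((6 * j + 3) * w) = (6 * j + 3) * (2 * w) := by ring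
          _ = (6 * j + 3) * (n + D) := by rw [h2w]
          _ = 2 * ((3 * j + 1) * n) + (n + (6 * j + 3) * D) := by ring
      have hrel : (6 * j + 3) * D = 3 * ((2 * j + 1) * D) := by ring
      have hZodd : (6 * j + 3) * D % 2 = 1 := by
        rw [Nat.mul_mod, hDodd]; omega
      have hrepr : (6 * j + 3) * w = (3 * j + 1) * n + (n + (6 * j + 3) * D) / 2 := by omega
      have hr : (n + (6 * j + 3) * D) / 2 < n := by omega
      have h := H_small H (by omega) (3 ^ (k + 1)) (by positivity) h5 (Nat.Coprime.pow_left _ hc3)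
      rw [hu, mod_eq_of_repr hrepr hr] at h
      omega

/-- a `k ≥ 1` with `n/15 ≤ 3^k < n/5` -/
lemma exists_K {n : ℕ} (hn : 20 < n) (h5 : ¬ 5 ∣ n) :
    ∃ k, 1 ≤ k ∧ 5 * 3 ^ k < n ∧ n ≤ 15 * 3 ^ k := by
  have ht : 3 ≤ n / 5 := by omega
  have hk1 : 1 ≤ Nat.log 3 (n / 5) := Nat.log_pos (by norm_num) ht
  have h1 := Nat.pow_log_le_self 3 (x := n / 5) (by omega)
  have h2 := Nat.lt_pow_succ_log_self (b := 3) (by norm_num) (n / 5)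
  rw [Nat.succ_eq_add_one, pow_succ] at h2
  exact ⟨Nat.log 3 (n / 5), hk1, by omega, by omega⟩

/-- case B gives `w = 2⁻¹`, i.e. `2⟨w⟩ = n + 1` -/
lemma caseB {n w : ℕ} (hn : 20 < n) (hodd : n % 2 = 1) (h5 : ¬ 5 ∣ n) (H : DigitClose n w)
    (hc3 : Nat.Coprime 3 n) (hB : n ≤ 2 * w) (hB' : 15 * w < 8 * n) : 2 * w = n + 1 := by
  obtain ⟨k, hk1, h5k, h15k⟩ := exists_K hn h5
  have h := chainB hn hodd H hc3 hB hB' k hk1 h5k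
  have h' : 3 ^ k * (5 * (2 * w - n)) < 3 ^ k * 15 := by
    calc 3 ^ k * (5 * (2 * w - n)) = 5 * (3 ^ k * (2 * w - n)) := by ring
      _ < n := h
      _ ≤ 15 * 3 ^ k := h15k
      _ = 3 ^ k * 15 := by ring
  have := Nat.lt_of_mul_lt_mul_left h'
  omega

/-! ## Steps 1–3 together, Step 4 (symmetry `w ↦ w⁻¹`), and the lemma -/

/-- Steps 1–3: any `w < n` satisfying the hypothesis has `⟨w⟩ ≤ 4` or `w = 2⁻¹` -/
lemma core {n w : ℕ} (hn : 20 < n) (h30 : Nat.Coprime n 30) (hwn : w < n) (H : DigitClose n w) :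
    w ≤ 4 ∨ 2 * w = n + 1 := by
  have hc2 : Nat.Coprime 2 n := (Nat.Coprime.coprime_dvd_right (by norm_num : 2 ∣ 30) h30).symm
  have hc3 : Nat.Coprime 3 n := (Nat.Coprime.coprime_dvd_right (by norm_num : 3 ∣ 30) h30).symm
  have hc5 : Nat.Coprime 5 n := (Nat.Coprime.coprime_dvd_right (by norm_num : 5 ∣ 30) h30).symm
  have hodd : n % 2 = 1 := Nat.odd_iff.mp (Nat.coprime_two_left.mp hc2)
  have h5 : ¬ 5 ∣ n := (Nat.Prime.coprime_iff_not_dvd Nat.prime_five).mp hc5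
  rcases step1 hn hwn H hc2 hc3 with hA | ⟨hB, hB'⟩
  · exact Or.inl (caseA hn h5 H hc2 hc3 hA)
  · exact Or.inr (caseB hn hodd h5 H hc3 hB hB')

/-- Step 4: the hypothesis is invariant under `w ↦ w⁻¹` (substitute `u ↦ u w⁻¹`) -/
lemma digitClose_inv {n w v : ℕ} (hn : 1 < n) (hv : w * v % n = 1) (H : DigitClose n w) :
    DigitClose n v := by
  have hcv : Nat.Coprime v n := by
    refine Nat.coprime_of_mul_modEq_one w ?_
    show v * w % n = 1 % n
    rw [Nat.mul_comm, hv, Nat.mod_eq_of_lt hn]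
  intro u hu0 hun hcu
  obtain ⟨u', hu'⟩ : ∃ u', u' = u * v % n := ⟨_, rfl⟩
  have hu'n : u' < n := by rw [hu']; exact Nat.mod_lt _ (by omega)
  have hcu' : Nat.Coprime u' n := by
    have hc : Nat.Coprime (u * v) n := Nat.coprime_mul_iff_left.mpr ⟨hcu, hcv⟩
    unfold Nat.Coprime at hc ⊢
    rw [hu', ← Nat.gcd_rec, Nat.gcd_comm]
    exact hc
  have hu'0 : 0 < u' := by
    rcases Nat.eq_zero_or_pos u' with h0 | h0
    · exfalso
      rw [h0] at hcu'
      have h1 : Nat.gcd 0 n = 1 := hcu'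
      rw [Nat.gcd_zero_left] at h1
      omega
    · exact h0
  obtain ⟨h1, h2⟩ := H u' hu'0 hu'n hcu'
  have e1 : u' * w % n = u % n := by
    rw [hu', Nat.mod_mul_mod, Nat.mul_assoc, Nat.mul_comm v w, Nat.mul_mod, hv, Nat.mul_one,
      Nat.mod_mod]
  have e1' : digit n (u' * w) = digit n u := by unfold digit; rw [e1]
  have e2' : digit n u' = digit n (u * v) := by unfold digit; rw [hu', Nat.mod_mod]
  rw [e1', e2'] at h1 h2
  exact ⟨h2, h1⟩

/-- **The DIGIT LEMMA** (`tables/KR-FREE.md` §5; Koblitz–Rohrlich 1978, p. 1195, the omitted Lemma, second part):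
for `gcd(n,30) = 1`, `n > 20` and a unit `w ≠ 1` of `ℤ/n`, if `|d(u) − d(uw)| ≤ 2` for every unit `u`, then
`w = 2` or `w = 2⁻¹ = (n+1)/2`. -/
theorem digit_lemma {n w : ℕ} (hn : 20 < n) (h30 : Nat.Coprime n 30) (hw1 : 1 < w) (hwn : w < n)
    (hwc : Nat.Coprime w n) (H : DigitClose n w) : w = 2 ∨ 2 * w = n + 1 := by
  obtain ⟨v, hvn, hv⟩ := Nat.exists_mul_mod_eq_one_of_coprime hwc (by omega)
  have Hv : DigitClose n v := digitClose_inv (by omega) hv H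
  rcases core hn h30 hwn H with hw4 | hw
  · rcases core hn h30 hvn Hv with hv4 | hvv
    · exfalso
      have hle : w * v ≤ 4 * 4 := Nat.mul_le_mul hw4 hv4
      rw [Nat.mod_eq_of_lt (by omega : w * v < n)] at hv
      have := Nat.eq_one_of_mul_eq_one_right hv
      omega
    · interval_cases w
      · exact Or.inl rfl
      · exfalso
        have hrepr : 3 * v = 1 * n + (n + 3) / 2 := by omega
        rw [mod_eq_of_repr hrepr (by omega)] at hv
        omega
      · exfalso
        have hrepr : 4 * v = 2 * n + 2 := by omega
        rw [mod_eq_of_repr hrepr (by omega)] at hv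
        omega
  · exact Or.inr hw

/-! ## Sharpness and sanity (not used): `w = 2` does satisfy the hypothesis at `n = 77`; the statement at `n = 7`·`11` by `decide` -/

/-- executable version of the hypothesis, for the sanity checks only -/
def digitCloseB (n w : ℕ) : Bool :=
  (List.range n).all fun u =>
    u = 0 || Nat.gcd u n ≠ 1 || (digit n (u * w) ≤ digit n u + 2 && digit n u ≤ digit n (u * w) + 2)

/-- at `n = 77` the units `w ≠ 1` passing the test are exactly `2` and `2⁻¹ = 39` -/
theorem sanity_77 : ((List.range 77).filter fun w => 1 < w ∧ Nat.gcd w 77 = 1 ∧ digitCloseB 77 w) = [2, 39] := by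
  decide +kernel

#print axioms digit_lemma

end HodgeFermat.KRFree
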